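import Summits.ResolutionOfSingularities.ResolutionOfSingularities.Theorems.FrobeniusClosingSteerOrderInductionWords
import Summits.ResolutionOfSingularities.ResolutionOfSingularities.Theorems.FrobeniusClosingSteerArithReduction
import Summits.ResolutionOfSingularities.ResolutionOfSingularities.Theorems.FrobeniusClosingSteerHevLeafWords
import HarnessLib

/-!
# FrobeniusClosingSteerDropLeafWords — the WORDS of the hK4ᶜᴵ LEAF v2 (binder `hK4ᶜᴵ` of the `Steer` T-line, W4.1) and its glue G1∨

OURS (campaign `res-hironaka`, rung L ★L-G4, slot W4.1, crux `Steer` stmt-ResolutionOfSingularities-16345; filer res-D-pv-036 g10 on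
res-L0-w41-plan-1 RULINGS 208(a)/210(a)/211(a)/217(a); TEXT = res-L0-w41-strat-1 g10's hK4ᶜᴵ LEAF v2 candidate **v1.4.1**
`L/res-L0-w41-strat-1/Sketch-strat1-g10-drop-v141.lean` sha16 0720297aa573547c (tri-1 TRIAGE v6.27 R-DR′ + v6.31 R-DR″ BYTE CHECK PASS
2026-08-27T17:52Z), cut per res-L0-w41-strat-2 g3's filing guidance 17:37:21Z (1)–(6)). Replaces the role of NOTHING in the manuscript under
review [claim: Hironaka2017, status: under-review]: these are the campaign's OWN words; nothing here is attributed to its author; nothing is a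
Literature fact; AI review is weaker than expert review.

Binder **hK4ᶜᴵ** = `StrippingTailSwitchingArithCompanionConclIndTwoN` (lead-1's skeleton `Steer` r48 380a05c149e3c83c l.4749–4765, RESTATED
VERBATIM here — token-identical body — so that the glue concludes it BY NAME; the skeleton's δ-bridge is `fun h => h`; the run words
`IsPosStepTwo` / `HeightTwoStepsInfinite` / `NoSingularSurfaceAt` are the tree's `…SwitchingDichotomy.HevLeaf` copies (r42 VERBATIM bodies,
`…SteerHevLeafWords`), not re-declared). Contents:
* the hNS♯ v1.3 DEVICE vocabulary (T5 (S) twisted per-stage radicand + T1 union form): `XEquiOrderedAlongTw`, `IsBranchOver`,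
  `strictTransformIdeal`, `InSingOfStrict`, `IsDeviceCentreW`, `IsDeviceCentreTw`, `IsTwistedStrictTransform`, `CompanionRegularisableTwAt`,
  `CompanionRegularisableWAt` (+ the pure-logic projection), `CompanionCentresXEquiOrderedTwoN`, and **hNS♯** `NoCompanionSingularSurfaceSharpTwoN`;
* the member relation `MemberOver` with `concl_transport` / `memberOver_refl` / `memberOver_trans` / `memberOver_of_mem` (DR-j junk note);
* **Dropᴵ** `CompanionRestartBelowStartTwoN` (record) and G1 `companionConclInd_of_sharp_of_restartBelow : hNS♯ → Dropᴵ → hK4ᶜᴵ`;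
* DR-3 named support word `CoreDatumTransferTwoN` (v1.4.1 form, WITH the conjunct `t' ^ p ∈ A₀'`, tri-1 DR′-3);
* the named word `CleanerReachesTwoOfCoreDatumTwoN` (DR-1 signature; DISCHARGED in the tree by res-L0-w41-strat-2's
  `OrderInductionDR1.cleanerReaches_two_of_coreDatum`, `…SteerCleanerReachesTwo.lean` — NOT imported here: zero coupling between the two
  review lanes, the skeleton feeds it by name) and `cleanerReaches_three_of_gap (hCR : CleanerReachesTwoOfCoreDatumTwoN)`;
* **Dropᴵ∨** `CompanionRestartBelowStartOrConclTwoN`, `restartBelowOrConcl_of_restartBelow`, and the GLUE OF RECORD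
  **G1∨ `companionConclInd_of_sharp_of_restartBelowOrConcl : hNS♯ → Dropᴵ∨ → hK4ᶜᴵ`** (pure logic, sorry-free).
OMITTED on purpose (RULING 208(a) / tri-1 DR′-6: record-only in the sketch): Dropᵇ_c `CompanionDropBelowCurrentTwoN c`, G2 and the slack
lemmas. By-hand proofs and audit trail: strat-1 `L/res-L0-w41-strat-1/{HNS-SHARP.md v1.3, DROP-DATUM.md, DROP-BENCH.md, W9-DATUM.md}`, tri-1
`L/res-L0-w41-tri-1/TRIAGE.md` rows R-DR / R-DR′ / R-DR″, strat-2 `L/res-L0-w41-strat-2/DR1/README-DR1.md`. No `sorry`, no new axioms: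
`def … : Prop` words + pure-logic theorems. (folklore)
-/

set_option linter.dupNamespace false
set_option autoImplicit false

namespace Summit.ResolutionOfSingularities.ResolutionOfSingularities.Theorems.SwitchingDichotomy.Words.DropLeaf

open IsLocalRing
open Literature.AlgebraicGeometry.Resolution (IsLocalBlowupAlong IsQuadraticTransform IsExcellentRing locAtCentre)
open Summit.ResolutionOfSingularities.ResolutionOfSingularities.Theorems.SteerRankThinness (Concl HasProperCoarsening)
open Summit.ResolutionOfSingularities.ResolutionOfSingularities.Theorems.SwitchingDichotomy.SigmaTopLegality (IsPointStep IsPosStep)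
open Summit.ResolutionOfSingularities.ResolutionOfSingularities.Theorems.SwitchingDichotomy.ArithReduction
  (OddCleanedPointStepAt ArithSwitchClause)
open Summit.ResolutionOfSingularities.ResolutionOfSingularities.Theorems.SwitchingDichotomy.HevLeaf
  (IsPosStepTwo HeightTwoStepsInfinite NoSingularSurfaceAt)

variable {K : Type} [Field K]

/-! ## The leaf's target word hK4ᶜᴵ (r48 l.4749–4765 VERBATIM body) -/

/-- **hK4ᶜᴵ · StrippingTailSwitchingArithCompanionConclIndTwoN** — lead-1's skeleton `Steer` r48 l.4749–4765 VERBATIM (= r46 l.5243 = r47 l.5260):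
hK4ᶜ + the order-induction binder `OrderInduction.ConclBelowDatum`; THE SLOT this file's glue G1∨ closes BY NAME. OURS. (folklore) -/
def StrippingTailSwitchingArithCompanionConclIndTwoN : Prop :=
  ∀ p : ℕ, p = 2 →
    ∀ (k K : Type) [Field k] [CharP k p] [PerfectField k] [Field K] [Algebra k K]
    (O : ValuationSubring K) (A₀ : Subalgebra k K) (h₀ : A₀.toSubring ≤ O.toSubring) (t : K),
    CoreDatum p 4 k K O A₀ h₀ t → ¬ HasProperCoarsening O →
    ∀ (R : ℕ → Subring K) (P : (i : ℕ) → Ideal (R i)) (s : ℕ → K),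
      R 0 = locAtCentre A₀.toSubring O → NormalAt O (R 0) p t → IsSteeredRun O R P t p s →
      (¬ ∃ i₀ c : ℕ, 1 ≤ c ∧ IsDominantTail R P i₀ c) →
      (∃ i₀ : ℕ, ∀ i, i₀ ≤ i → IsHighOrderAt R s p i) →
      ¬ HeightTwoStepsInfinite R P → {j | IsPosStep R P j}.Infinite →
      (∀ i₀ : ℕ, ∃ i, i₀ ≤ i ∧ IsPointStep R P i ∧
        ∀ hs : s i ^ p ∈ R i, ¬ HasIsolatedSingularity (RadicandRing (R i) p ⟨s i ^ p, hs⟩)) →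
      (¬ ∃ i₀ : ℕ, ∃ x : K, x ≠ 0 ∧ x ∈ O ∧ O.valuation x < 1 ∧
        ∀ i, i₀ ≤ i → ∀ y ∈ R i, O.valuation y < 1 → ∃ j, i < j ∧ y / x ∈ R j) →
      ArithSwitchClause R P s p →
      (∀ i₀ : ℕ, ∃ i, i₀ ≤ i ∧ OddCleanedPointStepAt R P s p i ∧ ¬ NoSingularSurfaceAt R s p i) →
      OrderInduction.ConclBelowDatum p k K O A₀ t → Concl O A₀ t


/-! ## hNS♯ v1.3 device vocabulary (T5 (S) + T1; OURS) -/

/-- **T5 (S) · X-SIDE at one centre, TWISTED form**: for the stage datum `(u, Φ)` (radicand `f = w^p · u · Φ`), every 𝔪-adic order reached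
by `Φ − u·g^p` is reached `C`-adically — «cleaned order along `V(C)` = cleaned order at the closed point, modulo `u`·(p-th powers)».  With
`u = 1, Φ = f` this is g9's `XEquiOrderedAlong`.  OURS. (folklore) -/
def XEquiOrderedAlongTw (S : Subring K) [IsLocalRing S] (p : ℕ) (u Φ : S) (C : Ideal S) : Prop :=
  ∀ n : ℕ, (∃ g : S, Φ - u * g ^ p ∈ (maximalIdeal S) ^ n) → ∃ g : S, Φ - u * g ^ p ∈ C ^ n

/-- g9 VERBATIM (T2 ✓): a prime of the bigger stage ring is a BRANCH of the strict transform of `V(Q)`: contracts to `Q`, same dimension. -/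
def IsBranchOver (S₀ S : Subring K) (Q : Ideal S₀) (Q' : Ideal S) : Prop :=
  ∃ h : S₀ ≤ S, Q'.IsPrime ∧ Ideal.comap (Subring.inclusion h) Q' = Q ∧ ringKrullDim (S ⧸ Q') = ringKrullDim (S₀ ⧸ Q)

/-- **T1 · the reduced ideal of the strict transform of `V(Q)` in `S`** = the intersection of its branches. OURS. (folklore) -/
def strictTransformIdeal (S₀ S : Subring K) (Q : Ideal S₀) : Ideal S :=
  sInf {Q' : Ideal S | IsBranchOver S₀ S Q Q'}

/-- **T1 · W-SIDE at one centre, UNION form**: `V(C)` lies on the reduced strict transform `V(J)` of `V(Q)` and inside its SINGULAR locus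
(the local ring of `S ⧸ J` at `C` is not regular) — crossing points/curves of two branches included.  OURS. (folklore) -/
def InSingOfStrict (S₀ S : Subring K) (Q : Ideal S₀) (C : Ideal S) : Prop :=
  strictTransformIdeal S₀ S Q ≤ C ∧
    ∀ [_hC : (Ideal.map (Ideal.Quotient.mk (strictTransformIdeal S₀ S Q)) C).IsPrime],
      ¬ IsRegularLocalRing (Localization.AtPrime (Ideal.map (Ideal.Quotient.mk (strictTransformIdeal S₀ S Q)) C))

/-- W-device centre (T1 form): a regular prime centre inside the singular locus of the reduced strict transform. OURS. (folklore) -/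
def IsDeviceCentreW (S₀ S : Subring K) (Q : Ideal S₀) (C : Ideal S) : Prop :=
  ∃ _ : IsLocalRing S, C.IsPrime ∧ IsRegularLocalRing (S ⧸ C) ∧ InSingOfStrict S₀ S Q C

/-- **Device centre, v1.3** = W-side (T1 union form) ∧ X-side (T5 twisted form) for the stage datum `(u, Φ)`.  (DR-7) POINT CENTRES
(`C = 𝔪_S`) ARE ALLOWED — the X-test `XEquiOrderedAlongTw` is then trivially true, and the W-test asks that the closed point be a singular
point of the reduced strict transform. OURS. (folklore) -/
def IsDeviceCentreTw (S₀ S : Subring K) (p : ℕ) (u Φ : K) (Q : Ideal S₀) (C : Ideal S) : Prop :=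
  ∃ (_ : IsLocalRing S) (hu : u ∈ S) (hΦ : Φ ∈ S), C.IsPrime ∧ IsRegularLocalRing (S ⧸ C) ∧ InSingOfStrict S₀ S Q C ∧
    XEquiOrderedAlongTw S p ⟨u, hu⟩ ⟨Φ, hΦ⟩ C

/-- **T5 · SQUARE-FREE-TWISTED STRICT-TRANSFORM transport** of the stage datum across the blow-up of `S` along `C` into `S'`: with an
exceptional parameter `e` (`IsExcParamAlong`), `Φ = e^ν · Φ'` with `Φ' ∈ S'` not divisible by `e` in `S'`, and the twist absorbs the residue
of `ν` mod `p` UP TO `p`-TH POWERS OF `S'` — **v1.4 (DR-6, tri-1 R-DR/v13) NORMALISED PER TRANSPORT**: `u · e^ν = u' · v^p` for some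
`v ∈ S'`, `v ≠ 0` (the `p`-th power goes into the torsor generator, `w' = w·v`), with `u' ∈ S'` and `u'` `p`-FREE IN THE CURRENT EXCEPTIONAL
PARAMETER (`u' / e^p ∉ S'`; R-J4a form `u = x^a y^b`, `a b ≤ p − 1`, at two-parameter stages).  This is the pick asked by RULING 201(c): the
old rigid `u' = u · e^(ν % p)` let old letters re-factor through new ones (`u₂ = x₂²·y₂`, tri-1's toy `Φ = τ² + x³`: `u = x²` reaches only order 2,
`u = 1` order 3), so the X-test drifted from the member's cleaned order; with the `p`-free normalisation `u = x²` is not admissible (`v = x`,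
`u' = 1`).  The `…BetaTwistParity` transport (186f) is NOT in the tree; when it lands it replaces this clause.  OURS. (folklore) -/
def IsTwistedStrictTransform (O : ValuationSubring K) (S : Subring K) (C : Ideal S) (S' : Subring K) (p : ℕ)
    (u Φ u' Φ' : K) : Prop :=
  ∃ e : K, IsExcParamAlong O S C e ∧ ∃ ν : ℕ, Φ = e ^ ν * Φ' ∧ Φ' ∈ S' ∧ Φ' / e ∉ S' ∧
    ∃ v : K, v ∈ S' ∧ v ≠ 0 ∧ u * e ^ ν = u' * v ^ p ∧ u' ∈ S' ∧ u' / e ^ p ∉ S'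

/-- **hNS♯ LOCAL FORM, v1.3 · CompanionRegularisableTwAt O S₀ p f Q**: a finite chain of local blowing ups along `O` at device centres,
threading the twisted stage datum `(u l, Φ l)` from `(1, f)`, after which every branch over `Q` is regular (per-branch; crossing regular
branches are terminal — each is σ_top-permissible).  OURS. (folklore) -/
def CompanionRegularisableTwAt (O : ValuationSubring K) (S₀ : Subring K) (p : ℕ) (f : K) (Q : Ideal S₀) : Prop :=
  ∃ (m : ℕ) (S : ℕ → Subring K) (C : (l : ℕ) → Ideal (S l)) (u Φ : ℕ → K),
    S 0 = S₀ ∧ u 0 = 1 ∧ Φ 0 = f ∧ (∀ l, S l ≤ S (l + 1)) ∧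
    (∀ l, l < m → IsLocalBlowupAlong O (S l) (C l) (S (l + 1)) ∧ IsDeviceCentreTw S₀ (S l) p (u l) (Φ l) Q (C l) ∧
      IsTwistedStrictTransform O (S l) (C l) (S (l + 1)) p (u l) (Φ l) (u (l + 1)) (Φ (l + 1))) ∧
    (∀ Q' : Ideal (S m), IsBranchOver S₀ (S m) Q Q' → IsRegularLocalRing (S m ⧸ Q'))

/-- W-side alone (what [CJS] Thm 1.3/1.4 + localisation prices), T1 form. OURS. (folklore) -/
def CompanionRegularisableWAt (O : ValuationSubring K) (S₀ : Subring K) (Q : Ideal S₀) : Prop :=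
  ∃ (m : ℕ) (S : ℕ → Subring K) (C : (l : ℕ) → Ideal (S l)),
    S 0 = S₀ ∧ (∀ l, S l ≤ S (l + 1)) ∧
    (∀ l, l < m → IsLocalBlowupAlong O (S l) (C l) (S (l + 1)) ∧ IsDeviceCentreW S₀ (S l) Q (C l)) ∧
    (∀ Q' : Ideal (S m), IsBranchOver S₀ (S m) Q Q' → IsRegularLocalRing (S m ⧸ Q'))

/-- The full device is in particular a W-device (drop the X-test and the twist datum). Pure logic. -/
theorem companionRegularisableWAt_of_companionRegularisableTwAt {O : ValuationSubring K} {S₀ : Subring K} {p : ℕ} {f : K}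
    {Q : Ideal S₀} (h : CompanionRegularisableTwAt O S₀ p f Q) : CompanionRegularisableWAt O S₀ Q := by
  obtain ⟨m, S, C, u, Φ, hS0, -, -, hmono, hstep, hterm⟩ := h
  refine ⟨m, S, C, hS0, hmono, fun l hl => ?_, hterm⟩
  obtain ⟨hblow, ⟨hloc, hu, hΦ, hprime, hreg, hsing, -⟩, -⟩ := hstep l hl
  exact ⟨hblow, hloc, hprime, hreg, hsing⟩

/-- **X-side permanence · CompanionCentresXEquiOrderedTwoN**, v1.3 wording (the l = 0 word: `u = 1`, `Φ = s i ^ p`; W-clause in T1 form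
with `S₀ = S = R i`, where the reduced strict transform of `V(Q)` is `V(Q)` itself).  UNAFFECTED by T5 (R-HS): TRUE late on the Φ(a,b) bench
family and its passengers, FALSE non-late (Φ″ at stage 0).  Prices the run's OWN stages; the device's intermediate rings are covered inside
`CompanionRegularisableTwAt`.  OURS. (folklore) -/
def CompanionCentresXEquiOrderedTwoN : Prop :=
  ∀ p : ℕ, p = 2 →
    ∀ (k K : Type) [Field k] [CharP k p] [PerfectField k] [Field K] [Algebra k K]
    (O : ValuationSubring K) (A₀ : Subalgebra k K) (h₀ : A₀.toSubring ≤ O.toSubring) (t : K),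
    CoreDatum p 4 k K O A₀ h₀ t → ¬ HasProperCoarsening O →
    ∀ (R : ℕ → Subring K) (P : (i : ℕ) → Ideal (R i)) (s : ℕ → K),
      R 0 = locAtCentre A₀.toSubring O → NormalAt O (R 0) p t → IsSteeredRun O R P t p s →
      (∀ i₀ : ℕ, ∃ i, i₀ ≤ i ∧ OddCleanedPointStepAt R P s p i ∧ ¬ NoSingularSurfaceAt R s p i) →
      ∃ i₀ : ℕ, ∀ i, i₀ ≤ i → OddCleanedPointStepAt R P s p i →
        ∀ (hs : s i ^ p ∈ R i) (Q : Ideal (R i)) [Q.IsPrime], IsSingPrime (R i) p ⟨s i ^ p, hs⟩ Q →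
          ¬ ringKrullDim (R i ⧸ Q) ≤ 1 →
          ∀ C : Ideal (R i), IsDeviceCentreW (R i) (R i) Q C →
            ∃ _ : IsLocalRing (R i), XEquiOrderedAlongTw (R i) p 1 ⟨s i ^ p, hs⟩ C

/-- **hNS♯ v1.3 · NoCompanionSingularSurfaceSharpTwoN** (leaf input; binders = hK4ᶜᴵ's without `hbelow`, VERBATIM; conclusion = g9's with the v1.3 local form `CompanionRegularisableTwAt`): «beyond every stage there is a companion A-stage at which EVERY companion prime is regularisable along `O` by finitely many twisted-X-equi-ordered regular centres inside the singular locus of its reduced strict transform».  W-side = [CJS] Thm 1.3/1.4 + localisation; X-side = `CompanionCentresXEquiOrderedTwoN` (late, l = 0) + the per-stage twisted test inside the chain.  Why it might fail: the X-side (a CJS centre along which the twisted stage radicand has smaller cleaned order than at the point; Φ″ at stage 0 is the non-late instance).  OURS. (folklore) -/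
def NoCompanionSingularSurfaceSharpTwoN : Prop :=
  ∀ p : ℕ, p = 2 →
    ∀ (k K : Type) [Field k] [CharP k p] [PerfectField k] [Field K] [Algebra k K]
    (O : ValuationSubring K) (A₀ : Subalgebra k K) (h₀ : A₀.toSubring ≤ O.toSubring) (t : K),
    CoreDatum p 4 k K O A₀ h₀ t → ¬ HasProperCoarsening O →
    ∀ (R : ℕ → Subring K) (P : (i : ℕ) → Ideal (R i)) (s : ℕ → K),
      R 0 = locAtCentre A₀.toSubring O → NormalAt O (R 0) p t → IsSteeredRun O R P t p s →
      (¬ ∃ i₀ c : ℕ, 1 ≤ c ∧ IsDominantTail R P i₀ c) →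
      (∃ i₀ : ℕ, ∀ i, i₀ ≤ i → IsHighOrderAt R s p i) →
      ¬ HeightTwoStepsInfinite R P → {j | IsPosStep R P j}.Infinite →
      (∀ i₀ : ℕ, ∃ i, i₀ ≤ i ∧ IsPointStep R P i ∧
        ∀ hs : s i ^ p ∈ R i, ¬ HasIsolatedSingularity (RadicandRing (R i) p ⟨s i ^ p, hs⟩)) →
      (¬ ∃ i₀ : ℕ, ∃ x : K, x ≠ 0 ∧ x ∈ O ∧ O.valuation x < 1 ∧
        ∀ i, i₀ ≤ i → ∀ y ∈ R i, O.valuation y < 1 → ∃ j, i < j ∧ y / x ∈ R j) →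
      ArithSwitchClause R P s p →
      (∀ i₀ : ℕ, ∃ i, i₀ ≤ i ∧ OddCleanedPointStepAt R P s p i ∧ ¬ NoSingularSurfaceAt R s p i) →
      ∀ i₀ : ℕ, ∃ i, i₀ ≤ i ∧ OddCleanedPointStepAt R P s p i ∧ ¬ NoSingularSurfaceAt R s p i ∧
        ∀ (hs : s i ^ p ∈ R i) (Q : Ideal (R i)) [Q.IsPrime], IsSingPrime (R i) p ⟨s i ^ p, hs⟩ Q →
          ¬ ringKrullDim (R i ⧸ Q) ≤ 1 → CompanionRegularisableTwAt O (R i) p (s i ^ p) Q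

/-! ## NEW — the member relation, the transport of `Concl`, and Drop's datum (OURS, candidates) -/

/-- **MemberOver A₀ A₀' t t'** — `(A₀', t')` is a RESTART MEMBER of the datum `(A₀, t)`: a bigger f.g.-type base through which
`t` factors affinely, `t = e · t' + g` with `e g ∈ A₀'` (the composite of the stagewise strict steps `s i = x · s (i+1) + g`,
`IsStrictStepAlong`, and of the device's steps).  This is exactly what the transport of `Concl` needs.  OURS. (folklore) -/
def MemberOver {k : Type} [Field k] [Algebra k K] (A₀ A₀' : Subalgebra k K) (t t' : K) : Prop :=
  A₀ ≤ A₀' ∧ ∃ e g : K, e ∈ A₀' ∧ g ∈ A₀' ∧ t = e * t' + g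

/-- **Transport of `Concl` from a restart member to the start** (PROVED): a regular f.g. model above `A₀'` containing `t'`
contains `A₀` and `t = e·t' + g`.  OURS. (folklore) -/
theorem concl_transport {k : Type} [Field k] [Algebra k K] {O : ValuationSubring K} {A₀ A₀' : Subalgebra k K} {t t' : K}
    (hmem : MemberOver A₀ A₀' t t') (h : Concl O A₀' t') : Concl O A₀ t := by
  obtain ⟨hle, e, g, he, hg, hte⟩ := hmem
  obtain ⟨A, hA, hA₀'A, ht'A, hFG, hfrac, hreg⟩ := h
  refine ⟨A, hA, le_trans hle hA₀'A, ?_, hFG, hfrac, hreg⟩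
  rw [hte]
  exact A.add_mem (A.mul_mem (hA₀'A he) ht'A) (hA₀'A hg)

/-- `MemberOver` is reflexive (`t = 1 · t + 0`). OURS. (folklore) -/
theorem memberOver_refl {k : Type} [Field k] [Algebra k K] (A₀ : Subalgebra k K) (t : K) : MemberOver A₀ A₀ t t :=
  ⟨le_rfl, 1, 0, A₀.one_mem, A₀.zero_mem, by ring⟩

/-- `MemberOver` is transitive (restart members of restart members). OURS. (folklore) -/
theorem memberOver_trans {k : Type} [Field k] [Algebra k K] {A₀ A₁ A₂ : Subalgebra k K} {t₀ t₁ t₂ : K}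
    (h₁ : MemberOver A₀ A₁ t₀ t₁) (h₂ : MemberOver A₁ A₂ t₁ t₂) : MemberOver A₀ A₂ t₀ t₂ := by
  obtain ⟨h01, e₁, g₁, he₁, hg₁, ht₁⟩ := h₁
  obtain ⟨h12, e₂, g₂, he₂, hg₂, ht₂⟩ := h₂
  refine ⟨le_trans h01 h12, e₁ * e₂, e₁ * g₂ + g₁, A₂.mul_mem (h12 he₁) he₂,
    A₂.add_mem (A₂.mul_mem (h12 he₁) hg₂) (h12 hg₁), ?_⟩
  rw [ht₁, ht₂]; ring

/-- **Dropᴵ · CompanionRestartBelowStartTwoN** (FRONTIER, OURS; THE WORD hK4ᶜᴵ CONSUMES).  hK4ᶜᴵ's binders VERBATIM (without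
`hbelow`) + hNS♯'s conclusion (beyond every stage a companion A-stage at which every companion prime admits a device) ⇒ there is a
RESTART MEMBER `(A₀', t')` of `(A₀, t)` — a core datum (`CoreDatum p 4`) over the same `O` — whose radicand MISSES an order that
`t ^ p` reaches at the start: `∃ d, CleanerReaches p O A₀ t d ∧ ¬ CleanerReaches p O A₀' t' d` (the hypothesis of
`OrderInduction.ConclBelowDatum`).  Content: device (hNS♯) + COOPERATIVE continuation (the restart's centres and charts are ours to
choose along `O`; the bench rule «blow up a permissible centre of MAXIMAL ν_W first» drops the order in ≤ 14 steps on 18 800 sampled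
companion configurations and kills the eternal engines E2/E4 in one step, DROP-BENCH §4) + re-entry of the last ring as a core datum
(f.g. model, `CoreDatum` inheritance) + the KEYING: the member's first cleaned order must be `< E₀` (start), not merely `< d_A`
(current) — rises at earlier surface steps (DROP-BENCH §3) make `d_A > E₀` possible; see `CompanionDropBelowCurrentTwoN` + EFO_c.
Why it might fail: the cooperative continuation leaves the companion regime after the first drop while still `≥ E₀` (no iterated
device), or `CoreDatum` (Shannon clause `¬(SS ∧ ArchSeq ∧ ¬Defect)`, derivation clause) is not inherited by the device ring. OURS. (folklore) -/
def CompanionRestartBelowStartTwoN : Prop :=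
  ∀ p : ℕ, p = 2 →
    ∀ (k K : Type) [Field k] [CharP k p] [PerfectField k] [Field K] [Algebra k K]
    (O : ValuationSubring K) (A₀ : Subalgebra k K) (h₀ : A₀.toSubring ≤ O.toSubring) (t : K),
    CoreDatum p 4 k K O A₀ h₀ t → ¬ HasProperCoarsening O →
    ∀ (R : ℕ → Subring K) (P : (i : ℕ) → Ideal (R i)) (s : ℕ → K),
      R 0 = locAtCentre A₀.toSubring O → NormalAt O (R 0) p t → IsSteeredRun O R P t p s →
      (¬ ∃ i₀ c : ℕ, 1 ≤ c ∧ IsDominantTail R P i₀ c) →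
      (∃ i₀ : ℕ, ∀ i, i₀ ≤ i → IsHighOrderAt R s p i) →
      ¬ HeightTwoStepsInfinite R P → {j | IsPosStep R P j}.Infinite →
      (∀ i₀ : ℕ, ∃ i, i₀ ≤ i ∧ IsPointStep R P i ∧
        ∀ hs : s i ^ p ∈ R i, ¬ HasIsolatedSingularity (RadicandRing (R i) p ⟨s i ^ p, hs⟩)) →
      (¬ ∃ i₀ : ℕ, ∃ x : K, x ≠ 0 ∧ x ∈ O ∧ O.valuation x < 1 ∧
        ∀ i, i₀ ≤ i → ∀ y ∈ R i, O.valuation y < 1 → ∃ j, i < j ∧ y / x ∈ R j) →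
      ArithSwitchClause R P s p →
      (∀ i₀ : ℕ, ∃ i, i₀ ≤ i ∧ OddCleanedPointStepAt R P s p i ∧ ¬ NoSingularSurfaceAt R s p i) →
      (∀ i₀ : ℕ, ∃ i, i₀ ≤ i ∧ OddCleanedPointStepAt R P s p i ∧ ¬ NoSingularSurfaceAt R s p i ∧
        ∀ (hs : s i ^ p ∈ R i) (Q : Ideal (R i)) [Q.IsPrime], IsSingPrime (R i) p ⟨s i ^ p, hs⟩ Q →
          ¬ ringKrullDim (R i ⧸ Q) ≤ 1 → CompanionRegularisableTwAt O (R i) p (s i ^ p) Q) →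
      ∃ (A₀' : Subalgebra k K) (h₀' : A₀'.toSubring ≤ O.toSubring) (t' : K),
        CoreDatum p 4 k K O A₀' h₀' t' ∧ MemberOver A₀ A₀' t t' ∧
        ∃ d : ℕ, OrderInduction.CleanerReaches p O A₀.toSubring t d ∧ ¬ OrderInduction.CleanerReaches p O A₀'.toSubring t' d

/-- **G1 — THE GLUE (kernel-checked, no sorry): hNS♯ ∧ Dropᴵ ⇒ hK4ᶜᴵ.**  hNS♯ strengthens the companion clause, Dropᴵ produces the
restart member, `hbelow` gives `Concl` there, `concl_transport` brings it back to `(A₀, t)`. -/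
theorem companionConclInd_of_sharp_of_restartBelow
    (hsharp : NoCompanionSingularSurfaceSharpTwoN) (hdrop : CompanionRestartBelowStartTwoN) :
    StrippingTailSwitchingArithCompanionConclIndTwoN := by
  intro p hp k K _ _ _ _ _ O A₀ h₀ t hcd hnc R P s hR0 hN hrun hnd hhigh h2 hinf hwild hsw harith hcomp hbelow
  have hs := hsharp p hp k K O A₀ h₀ t hcd hnc R P s hR0 hN hrun hnd hhigh h2 hinf hwild hsw harith hcomp
  obtain ⟨A₀', h₀', t', core', hmem, d, hd, hnd'⟩ :=
    hdrop p hp k K O A₀ h₀ t hcd hnc R P s hR0 hN hrun hnd hhigh h2 hinf hwild hsw harith hcomp hs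
  exact concl_transport hmem (hbelow A₀' h₀' t' core' ⟨d, hd, hnd'⟩)

/-! ## v1.4 · DR-3 NAMED SUPPORT WORD — `CoreDatum` transfer to restart members (RULING 199(a): 193a (iii) shrinks to this) -/

/-- **DR-3 · `CoreDatumTransferTwoN` (NAMED SUPPORT WORD; NOT consumed by the glue G1∨ — it is what a PROVER of Dropᴵ∨'s right disjunct
needs to certify `CoreDatum p 4 k K O A₀' h₀' t'` for the member it exhibits).**  Along `O` (rank one, residue field `k`): a member
`(A₀', t')` over `(A₀, t)` that (i) is finitely generated and stays DOWNSTAIRS (`A₀ ≤ A₀' ⊆ Frac A₀` inside `K`), (ii) is regular of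
dimension `> 2` at the centre of `O`, and (iii) is UNRESOLVED — `t' ^ p ∈ A₀'` (v1.4.1, tri-1 DR′-3: without it the unit rescaling
`t' := t / z`, `z ∈ 𝔮 ∖ 𝔭`, is junk) and its radicand reaches cleaned order 2 (`CleanerReaches p O A₀' t' 2`) —
inherits `CoreDatum p 4`.  Clause ledger (tri-1 R-DR DR-3): the `O`-clauses (`ZeroDim`, `¬ IsAbhyankarPlace`, `¬ DenseAbhyankar`,
`¬ Discrete`, `trdeg`) are verbatim; maximality of the centre from `ZeroDim`; `IsFractionRing` from `MemberOver`; the derivation clause ⟸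
(iii) (`δ (g^p + h) = δ h ∈ 𝔪` for `h ∈ 𝔪²`); the non-`p`-th-power clause ⟸ (i) + normality of the regular local ring (`t ∉ Frac A₀`);
`Defect` is INVARIANT under `t = e·t' + g` (tri-1, PROVED: `v (t'^p − g'^p) = v ((w/e)^p)`); the `StronglySwitching`/`ArchSeq` transfer is
the OPEN part for NON-QUADRATIC (device) members — automatic for members of `O`'s point sequence, and by RULING 203(e) `¬ StronglySwitching`
is automatic in the rank-one, dimension-4 arena (SS only in dim 2), which would make the last clause free.  Failure mode = the ENGINE case
(a member violating the Shannon clause), harmless for `Concl` once the caller reaches the engine (Dropᴵ∨ left disjunct). OURS. (folklore) -/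
def CoreDatumTransferTwoN : Prop :=
  ∀ p : ℕ, p = 2 →
    ∀ (k K : Type) [Field k] [CharP k p] [PerfectField k] [Field K] [Algebra k K]
    (O : ValuationSubring K) (A₀ : Subalgebra k K) (h₀ : A₀.toSubring ≤ O.toSubring) (t : K),
    CoreDatum p 4 k K O A₀ h₀ t → ¬ HasProperCoarsening O →
    ∀ (A₀' : Subalgebra k K) (h₀' : A₀'.toSubring ≤ O.toSubring) (t' : K),
      MemberOver A₀ A₀' t t' → A₀'.FG →
      (∀ x ∈ A₀', ∃ a ∈ A₀, ∃ b ∈ A₀, b ≠ 0 ∧ x = a / b) →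
      IsRegularLocalRing (Localization.AtPrime (Ideal.comap (Subring.inclusion h₀') (IsLocalRing.maximalIdeal O))) →
      ¬ ringKrullDim (Localization.AtPrime (Ideal.comap (Subring.inclusion h₀') (IsLocalRing.maximalIdeal O))) ≤ 2 →
      t' ^ p ∈ A₀' → OrderInduction.CleanerReaches p O A₀'.toSubring t' 2 →
      CoreDatum p 4 k K O A₀' h₀' t'


/-! ## tri-1 R-DR repair block (re-based on v13 0bfec34daf39afc5): DR-j junk note, DR-1 named word, Dropᴵ∨ + G1∨ -/

/-- (DR-j) `MemberOver` junk: with `e = 0`, ANY `t'` is a «member» as soon as `t ∈ A₀'`.  Harmless: `concl_transport` stays true, and inside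
Dropᴵ/Dropᵇ the member must be a `CoreDatum`, which excludes it (`t ∈ A₀'` ⇒ `Frac A₀' = K ∋ t'`, `t' ^ p ∈ S'`, `S'` regular ⇒ normal ⇒
`t' ∈ S'` ⇒ the non-`p`-th-power clause fails).  Optional cosmetic repair: add `e ≠ 0`. OURS. (folklore) -/
theorem memberOver_of_mem {k : Type} [Field k] [Algebra k K] {A₀ A₀' : Subalgebra k K} (hle : A₀ ≤ A₀') {t : K}
    (ht : t ∈ A₀') (t' : K) : MemberOver A₀ A₀' t t' :=
  ⟨hle, 0, t, A₀'.zero_mem, ht, by ring⟩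


/-! ## DR-1 as a NAMED WORD (discharged in the tree by `OrderInductionDR1.cleanerReaches_two_of_coreDatum`; fed by name, not imported) -/

/-- **DR-1 · `CleanerReachesTwoOfCoreDatumTwoN`** (NAMED WORD; signature = tri-1 `v624/RDR_DropRepair_v13.lean` l.348 with explicit binders):
A CORE DATUM REACHES CLEANED ORDER 2 — for every `CoreDatum p 4 k K O A₀ h₀ t`, `OrderInduction.CleanerReaches p O A₀ t 2`
(`t ^ p − g ^ p ∈ 𝔪²` at the root member). PROVED in the tree: res-L0-w41-strat-2's `OrderInductionDR1.cleanerReaches_two_of_coreDatum`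
(`…SteerCleanerReachesTwo.lean`; residue field perfect under `ZeroDim` + dual derivations at the regular root member + conormal detection);
the skeleton feeds `fun p k K _ _ _ _ _ O A₀ h₀ t h => OrderInductionDR1.cleanerReaches_two_of_coreDatum O A₀ h₀ t h`. OURS. (folklore) -/
def CleanerReachesTwoOfCoreDatumTwoN : Prop :=
  ∀ (p : ℕ) (k K : Type) [Field k] [CharP k p] [PerfectField k] [Field K] [Algebra k K]
    (O : ValuationSubring K) (A₀ : Subalgebra k K) (h₀ : A₀.toSubring ≤ O.toSubring) (t : K),
    CoreDatum p 4 k K O A₀ h₀ t → OrderInduction.CleanerReaches p O A₀.toSubring t 2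

/-- (DR-1, consequence, proved from the NAMED WORD `hCR`) In Dropᴵ's conclusion the gap order is `≥ 3`, hence THE START REACHES ORDER 3:
Dropᴵ silently asserts «companion binders ⇒ first cleaned order `E₀ ≥ 3`» and «some CoreDatum member has cleaned order in `[2, E₀ − 1]`». -/
theorem cleanerReaches_three_of_gap (hCR : CleanerReachesTwoOfCoreDatumTwoN)
    {p : ℕ} {k : Type} [Field k] [CharP k p] [PerfectField k] [Algebra k K]
    (O : ValuationSubring K) (A₀ A₀' : Subalgebra k K) (h₀' : A₀'.toSubring ≤ O.toSubring) (t t' : K)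
    (core' : CoreDatum p 4 k K O A₀' h₀' t')
    (hgap : ∃ d : ℕ, OrderInduction.CleanerReaches p O A₀.toSubring t d ∧ ¬ OrderInduction.CleanerReaches p O A₀'.toSubring t' d) :
    OrderInduction.CleanerReaches p O A₀.toSubring t 3 := by
  obtain ⟨d, hd, hnd⟩ := hgap
  have h2 := hCR p k K O A₀' h₀' t' core'
  have h3 : 3 ≤ d := by
    by_contra hlt
    exact hnd (OrderInduction.cleanerReaches_mono h2 (by omega))
  exact OrderInduction.cleanerReaches_mono hd h3


/-- **Dropᴵ∨ · CompanionRestartBelowStartOrConclTwoN** (tri-1 R-DR repair of Dropᴵ, zero cost for the glue): SAME binders, conclusion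
`Concl O A₀ t ∨ (restart member with an order gap)`.  Covers the two holes of Dropᴵ as typed — a start of exact cleaned order 2, and a cooperative
continuation that resolves outright (cleaned order jumps below 2) before any CoreDatum member with a gap appears — and the engine case at re-entry
(member failing the Shannon clause) once the caller can reach the engine. OURS. (folklore) -/
def CompanionRestartBelowStartOrConclTwoN : Prop :=
  ∀ p : ℕ, p = 2 →
    ∀ (k K : Type) [Field k] [CharP k p] [PerfectField k] [Field K] [Algebra k K]
    (O : ValuationSubring K) (A₀ : Subalgebra k K) (h₀ : A₀.toSubring ≤ O.toSubring) (t : K),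
    CoreDatum p 4 k K O A₀ h₀ t → ¬ HasProperCoarsening O →
    ∀ (R : ℕ → Subring K) (P : (i : ℕ) → Ideal (R i)) (s : ℕ → K),
      R 0 = locAtCentre A₀.toSubring O → NormalAt O (R 0) p t → IsSteeredRun O R P t p s →
      (¬ ∃ i₀ c : ℕ, 1 ≤ c ∧ IsDominantTail R P i₀ c) →
      (∃ i₀ : ℕ, ∀ i, i₀ ≤ i → IsHighOrderAt R s p i) →
      ¬ HeightTwoStepsInfinite R P → {j | IsPosStep R P j}.Infinite →
      (∀ i₀ : ℕ, ∃ i, i₀ ≤ i ∧ IsPointStep R P i ∧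
        ∀ hs : s i ^ p ∈ R i, ¬ HasIsolatedSingularity (RadicandRing (R i) p ⟨s i ^ p, hs⟩)) →
      (¬ ∃ i₀ : ℕ, ∃ x : K, x ≠ 0 ∧ x ∈ O ∧ O.valuation x < 1 ∧
        ∀ i, i₀ ≤ i → ∀ y ∈ R i, O.valuation y < 1 → ∃ j, i < j ∧ y / x ∈ R j) →
      ArithSwitchClause R P s p →
      (∀ i₀ : ℕ, ∃ i, i₀ ≤ i ∧ OddCleanedPointStepAt R P s p i ∧ ¬ NoSingularSurfaceAt R s p i) →
      (∀ i₀ : ℕ, ∃ i, i₀ ≤ i ∧ OddCleanedPointStepAt R P s p i ∧ ¬ NoSingularSurfaceAt R s p i ∧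
        ∀ (hs : s i ^ p ∈ R i) (Q : Ideal (R i)) [Q.IsPrime], IsSingPrime (R i) p ⟨s i ^ p, hs⟩ Q →
          ¬ ringKrullDim (R i ⧸ Q) ≤ 1 → CompanionRegularisableTwAt O (R i) p (s i ^ p) Q) →
      Concl O A₀ t ∨ ∃ (A₀' : Subalgebra k K) (h₀' : A₀'.toSubring ≤ O.toSubring) (t' : K),
        CoreDatum p 4 k K O A₀' h₀' t' ∧ MemberOver A₀ A₀' t t' ∧
        ∃ d : ℕ, OrderInduction.CleanerReaches p O A₀.toSubring t d ∧ ¬ OrderInduction.CleanerReaches p O A₀'.toSubring t' d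

/-- Dropᴵ ⇒ Dropᴵ∨ (pure logic). -/
theorem restartBelowOrConcl_of_restartBelow (h : CompanionRestartBelowStartTwoN) : CompanionRestartBelowStartOrConclTwoN := by
  intro p hp k K _ _ _ _ _ O A₀ h₀ t hcd hnc R P s hR0 hN hrun hnd hhigh h2 hinf hwild hsw harith hcomp hs
  exact Or.inr (h p hp k K O A₀ h₀ t hcd hnc R P s hR0 hN hrun hnd hhigh h2 hinf hwild hsw harith hcomp hs)

/-- **G1∨ (kernel-checked, no sorry): hNS♯ ∧ Dropᴵ∨ ⇒ hK4ᶜᴵ** — the glue is unchanged in the right disjunct and trivial in the left. -/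
theorem companionConclInd_of_sharp_of_restartBelowOrConcl
    (hsharp : NoCompanionSingularSurfaceSharpTwoN) (hdrop : CompanionRestartBelowStartOrConclTwoN) :
    StrippingTailSwitchingArithCompanionConclIndTwoN := by
  intro p hp k K _ _ _ _ _ O A₀ h₀ t hcd hnc R P s hR0 hN hrun hnd hhigh h2 hinf hwild hsw harith hcomp hbelow
  have hs := hsharp p hp k K O A₀ h₀ t hcd hnc R P s hR0 hN hrun hnd hhigh h2 hinf hwild hsw harith hcomp
  rcases hdrop p hp k K O A₀ h₀ t hcd hnc R P s hR0 hN hrun hnd hhigh h2 hinf hwild hsw harith hcomp hs with hC | ⟨A₀', h₀', t', core', hmem, d, hd, hnd'⟩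
  · exact hC
  · exact concl_transport hmem (hbelow A₀' h₀' t' core' ⟨d, hd, hnd'⟩)


end Summit.ResolutionOfSingularities.ResolutionOfSingularities.Theorems.SwitchingDichotomy.Words.DropLeaf
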